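import Literature.Probability.RandomPlanarGeometry.CritPercSLEDimensionUpperBound
import Literature.Probability.RandomPlanarGeometry.CritPercSLESpaceFillingIffTraceEight
import HarnessLib

/-!
# The dimension of the SLE_κ trace: the upper bound unconditionally, and what remains of Beffara's theorem

Topic `Probability/RandomPlanarGeometry`; theorems only (no definition, no new named fact).
Bookkeeping on the named fact `Literature.Probability.RandomPlanarGeometry.ae_dimH_range_sleTrace`
(`CritPercSLE.lean`; V. Beffara, *The dimension of the SLE curves*, Ann. Probab. 36 (2008),
Theorem of the Introduction: for `0 < κ ≤ 8`, almost surely `dim_H γ[0, ∞) = 1 + κ/8`), after the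
tree acquired proofs of Rohde–Schramm's Thm. 5.1 (`hasSLETrace_of_ne_eight_holds`), Thm. 7.1 for
`κ ≠ 8` (`tendsto_norm_sleTrace_atTop_of_ne_eight`), the one-point upper estimate for every
exponent `a < 1 - κ/8` (`measure_infDist_sleTrace_le`, Lemma 6.3 / Thm. 8.1) and the space-filling
phase from the SLE₈ trace theorem (`ae_isSpaceFilling_sleTrace_of_eight_le_of_hasSLETrace_eight`):

* `ae_dimH_range_sleTrace_le_of_lt_eight`, `ae_dimH_range_sleTrace_le_of_le_eight` —
  **Rohde–Schramm's Cor. 8.2, unconditionally**: for `0 < κ < 8` (resp. `0 < κ ≤ 8`), almost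
  surely `dim_H γ[0, ∞) ≤ 1 + κ/8` (the conditional `ae_dimH_range_sleTrace_le` of
  `CritPercSLEDimensionUpperBound.lean` with `HasSLETrace κ` supplied by Thm. 5.1; at `κ = 8` the
  bound is `2 = dim ℂ`);
* `ae_dimH_range_sleTrace_eight_iff_hasSLETrace_eight` — **the case `κ = 8` of the fact is
  equivalent to Lawler–Schramm–Werner's Thm. 4.7** (`hasSLETrace_eight`): `←` through the
  space-filling phase, `→` because on a sample path whose chain is not generated by a curve the
  trace of the tree is a constant path, of dimension `0 ≠ 2`;
* `ae_dimH_range_sleTrace_eq_of_lt_eight_of_estimates` — **for one `0 < κ < 8`, the conclusion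
  of the fact from the two remaining SLE estimates of Beffara's proof at that `κ`**, in their
  printed local form: the one-point *lower* estimate (Prop. 4, lower half) and the two-point
  estimate (§3, (3.5) with §3.2), everything else (0–1 law, second-moment method, energies, the
  upper bound, transience, existence of the trace) being proved;
* `ae_dimH_range_sleTrace_of_hasSLETrace_eight_of_lower_estimates` — the whole fact from
  `hasSLETrace_eight` and these two estimates. (The one-point lower estimate is the subject of
  `SLEOnePointLowerEstimate.lean`; with it, only the two-point estimate remains for `κ < 8`.)

## References

* V. Beffara, *The dimension of the SLE curves*, Ann. Probab. 36 (2008) 1421–1452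
  (arXiv:math/0211322v3): Theorem (Introduction), §1 (Prop. 1, Lemma 3), Prop. 4, §3 (3.5).
* S. Rohde, O. Schramm, *Basic properties of SLE*, Ann. of Math. 161 (2005): Thm. 5.1, Lemma 6.3,
  Thm. 7.1, Cor. 7.4, Thm. 8.1 and Cor. 8.2.
* G. F. Lawler, O. Schramm, W. Werner, *Conformal invariance of planar loop-erased random walks and
  uniform spanning trees*, Ann. Probab. 32 (2004), Thm. 4.7.
-/

noncomputable section

open Set Filter Topology MeasureTheory Metric Complex
open UpperHalfPlane (upperHalfPlaneSet isOpen_upperHalfPlaneSet)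
open Literature.MeasureTheory.Hausdorff
open scoped NNReal ENNReal

namespace Literature.Probability.RandomPlanarGeometry

open Loewner Literature.Probability.Process

variable {κ : ℝ≥0}

/-! ### The upper bound `dim_H γ[0, ∞) ≤ 1 + κ/8`, unconditionally -/

/-- **Rohde–Schramm (2005), Cor. 8.2, unconditionally**: for `0 < κ < 8`, almost surely
`dim_H γ[0, ∞) ≤ 1 + κ/8` — the conditional theorem `ae_dimH_range_sleTrace_le` of
`CritPercSLEDimensionUpperBound.lean` (one-point estimates for all exponents `a < 1 - κ/8`, dyadic
covering, `a ↑ 1 - κ/8`) with its hypothesis `HasSLETrace κ` discharged by Thm. 5.1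
(`hasSLETrace_of_ne_eight_apply`, proved in `RohdeSchrammCor35Proofs.lean`).
[cite: RohdeSchramm2005, Cor. 8.2] -/
theorem ae_dimH_range_sleTrace_le_of_lt_eight (hκ0 : 0 < κ) (hκ8 : κ < 8) :
    ∀ᵐ ω ∂preWienerMeasure, dimH (range (sleTrace κ ω)) ≤ 1 + (κ : ℝ≥0∞) / 8 :=
  ae_dimH_range_sleTrace_le hκ0 hκ8 (hasSLETrace_of_ne_eight_apply hκ8.ne)

/-- **The a.s. upper bound `dim_H γ[0, ∞) ≤ 1 + κ/8` for all `0 < κ ≤ 8`, unconditionally** (at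
`κ = 8` the bound `2` is the dimension of the plane). This is the upper half of
`ae_dimH_range_sleTrace` (Beffara (2008), Theorem; Rohde–Schramm (2005), Cor. 8.2).
[cite: RohdeSchramm2005, Cor. 8.2] -/
theorem ae_dimH_range_sleTrace_le_of_le_eight (hκ0 : 0 < κ) (hκ8 : κ ≤ 8) :
    ∀ᵐ ω ∂preWienerMeasure, dimH (range (sleTrace κ ω)) ≤ 1 + (κ : ℝ≥0∞) / 8 := by
  rcases hκ8.lt_or_eq with hlt | rfl
  · exact ae_dimH_range_sleTrace_le_of_lt_eight hκ0 hlt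
  · refine ae_of_all _ fun ω ↦ ?_
    rw [one_add_coe_eight_div_eight]
    calc dimH (range (sleTrace 8 ω)) ≤ dimH (univ : Set ℂ) := dimH_mono (subset_univ _)
      _ = 2 := by rw [Real.dimH_univ_eq_finrank, Complex.finrank_real_complex, Nat.cast_ofNat]

/-! ### The case `κ = 8` is the SLE₈ trace theorem -/

/-- **At `κ = 8` the fact is equivalent to Lawler–Schramm–Werner's Thm. 4.7** (`hasSLETrace_eight`:
SLE₈ is generated by a curve). `←`: the space-filling phase from the SLE₈ trace
(`ae_isSpaceFilling_sleTrace_of_eight_le_of_hasSLETrace_eight`, Rohde–Schramm's Cor. 7.4 with the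
Update) and `ae_dimH_range_sleTrace_eight_of_isSpaceFilling`; `→`: where the chain is not generated
by a curve the trace of the tree is the constant path `W₀`, whose range has dimension `0 ≠ 2`.
[cite: Beffara2008, Theorem (Introduction), case κ = 8; LawlerSchrammWerner2004, Thm 4.7] -/
theorem ae_dimH_range_sleTrace_eight_iff_hasSLETrace_eight :
    ae_dimH_range_sleTrace (κ := 8) ↔ hasSLETrace_eight := by
  refine ⟨fun h ↦ ?_, fun h8e ↦ ae_dimH_range_sleTrace_eight_of_isSpaceFilling
    (ae_isSpaceFilling_sleTrace_of_eight_le_of_hasSLETrace_eight h8e)⟩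
  have hae := h (by norm_num) le_rfl
  show ∀ᵐ ω ∂preWienerMeasure, ∃ γ, IsGeneratedByCurve (sleDriving 8 ω) γ
  filter_upwards [hae] with ω hω
  by_contra hne
  have hconst : sleTrace 8 ω = fun _ ↦ ((sleDriving 8 ω 0 : ℝ) : ℂ) := by
    unfold sleTrace Loewner.trace
    rw [dif_neg hne]
  rw [hconst, one_add_coe_eight_div_eight] at hω
  have hrange : range (fun _ : ℝ≥0 ↦ ((sleDriving 8 ω 0 : ℝ) : ℂ)) = {((sleDriving 8 ω 0 : ℝ) : ℂ)} :=
    range_const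
  rw [hrange, dimH_singleton] at hω
  exact two_ne_zero hω.symm

/-- **The fact at `κ = 8` from the SLE₈ trace theorem.** [cite: Beffara2008, Theorem (Introduction), case κ = 8] -/
theorem ae_dimH_range_sleTrace_eight_of_hasSLETrace_eight (h8e : hasSLETrace_eight) :
    ae_dimH_range_sleTrace (κ := 8) :=
  ae_dimH_range_sleTrace_eight_iff_hasSLETrace_eight.2 h8e

/-! ### `0 < κ < 8`: the conclusion from the two remaining estimates -/

/-- **For one `0 < κ < 8`: almost surely `dim_H γ[0, ∞) = 1 + κ/8`, given the one-point lower
estimate and the two-point estimate at this `κ`** in their printed local form (for every compact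
`K ⊆ ℍ`, constants and an `ε₀ > 0`):

* `hB` — Beffara (2008), Prop. 4 (lower half) / Cor. 5: `P(dist(z, γ[0, ∞)) ≤ ε) ≥ c₁ ε^{1-κ/8}`
  for `z ∈ K`, `0 < ε ≤ ε₀`;
* `hC` — Beffara (2008), §3, (3.5) with §3.2 ("condition 3"); independently Lawler–Werness,
  Ann. Probab. 41 (2013), Thm. 2: `P(dist(x, γ) ≤ ε, dist(y, γ) ≤ ε) ≤ c₃ ε^{2(1-κ/8)} |x-y|^{-(1-κ/8)}`
  for `x, y ∈ K`, `0 < ε ≤ ε₀`.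

Proof: the upper bound is `ae_dimH_range_sleTrace_le_of_lt_eight`; the lower bound holds with
positive probability by the second-moment method in the window `B̄(2i, 1)`
(`measure_dimH_range_sleTrace_ge_pos_of_estimates`, with the trace from Thm. 5.1 and transience
from Thm. 7.1, both proved), hence `{dim_H = 1 + κ/8}` has positive probability
(`measure_setOf_dimH_eq_pos_of_ae_le`), and Beffara's Lemma 3 (the 0–1 law,
`ae_dimH_range_sleTrace_eq_or_ae_ne`) makes it almost sure (`ae_dimH_range_sleTrace_eq_of_measure_pos`).
[cite: Beffara2008, Theorem (Introduction), §1 p. 1425, Prop. 1, Lemma 3, Prop. 4 and (3.5)] -/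
theorem ae_dimH_range_sleTrace_eq_of_lt_eight_of_estimates (hκ0 : 0 < κ) (hκ8 : κ < 8)
    (hB : ∀ K : Set ℂ, IsCompact K → K ⊆ upperHalfPlaneSet →
      ∃ c₁ : ℝ≥0∞, c₁ ≠ 0 ∧ ∃ ε₀ : ℝ, 0 < ε₀ ∧ ∀ ε : ℝ, 0 < ε → ε ≤ ε₀ → ∀ z ∈ K,
        c₁ * ENNReal.ofReal (ε ^ (1 - (κ : ℝ) / 8)) ≤
          preWienerMeasure {ω | infDist z (range (sleTrace κ ω)) ≤ ε})
    (hC : ∀ K : Set ℂ, IsCompact K → K ⊆ upperHalfPlaneSet →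
      ∃ c₃ : ℝ≥0∞, c₃ ≠ ⊤ ∧ ∃ ε₀ : ℝ, 0 < ε₀ ∧ ∀ ε : ℝ, 0 < ε → ε ≤ ε₀ → ∀ x ∈ K, ∀ y ∈ K,
        preWienerMeasure {ω | infDist x (range (sleTrace κ ω)) ≤ ε ∧
            infDist y (range (sleTrace κ ω)) ≤ ε} ≤
          c₃ * ENNReal.ofReal (ε ^ (1 - (κ : ℝ) / 8)) ^ 2 * rieszKernel (1 - (κ : ℝ) / 8) x y) :
    ∀ᵐ ω ∂preWienerMeasure, dimH (range (sleTrace κ ω)) = 1 + (κ : ℝ≥0∞) / 8 := by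
  have hT : HasSLETrace κ := hasSLETrace_of_ne_eight_apply hκ8.ne
  have htr := tendsto_norm_sleTrace_atTop_of_ne_eight hκ0 hκ8.ne
  -- the lower bound with positive probability, in the window `B̄(2i, 1)` along `εₙ = ε₀/(n+1)`
  have hL : 0 < preWienerMeasure {ω | 1 + (κ : ℝ≥0∞) / 8 ≤ dimH (range (sleTrace κ ω))} := by
    obtain ⟨hKc, hKH, hKv⟩ := window_props
    obtain ⟨c₁, hc₁, ε₁, hε₁, h1⟩ := hB _ hKc hKH
    obtain ⟨c₃, hc₃, ε₃, hε₃, h3⟩ := hC _ hKc hKH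
    set ε₀ : ℝ := min ε₁ ε₃ with hε₀
    have hε₀pos : 0 < ε₀ := lt_min hε₁ hε₃
    set ε : ℕ → ℝ := fun n ↦ ε₀ / ((n : ℝ) + 1) with hε
    have hεpos : ∀ n, 0 < ε n := fun n ↦ by rw [hε]; positivity
    have hεle : ∀ n, ε n ≤ ε₀ := fun n ↦ by
      rw [hε]
      exact div_le_self hε₀pos.le (by linarith [(Nat.cast_nonneg n : (0 : ℝ) ≤ n)])
    have hεanti : Antitone ε := fun m n hmn ↦ by
      simp only [hε]
      exact div_le_div_of_nonneg_left hε₀pos.le (by positivity)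
        (by exact_mod_cast Nat.add_le_add_right hmn 1)
    have hεlim : Tendsto ε atTop (𝓝 0) := by
      have h := (tendsto_one_div_add_atTop_nhds_zero_nat (𝕜 := ℝ)).const_mul ε₀
      rw [mul_zero] at h
      refine h.congr fun n ↦ ?_
      simp only [hε]
      ring
    exact measure_dimH_range_sleTrace_ge_pos_of_estimates hT hκ8 htr hKc hKv hεpos hεanti hεlim hc₁ hc₃
      (fun n z hz ↦ h1 (ε n) (hεpos n) ((hεle n).trans (min_le_left _ _)) z hz)
      (fun n x hx y hy ↦ h3 (ε n) (hεpos n) ((hεle n).trans (min_le_right _ _)) x hx y hy)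
  exact ae_dimH_range_sleTrace_eq_of_measure_pos
    (measure_setOf_dimH_eq_pos_of_ae_le (ae_dimH_range_sleTrace_le_of_lt_eight hκ0 hκ8) hL)
    (ae_dimH_range_sleTrace_eq_or_ae_ne hT _)

/-- **`ae_dimH_range_sleTrace` from the SLE₈ trace theorem and the two remaining estimates of
Beffara's proof** (one-point lower estimate, Prop. 4; two-point estimate, (3.5)), for every `κ`:
`κ < 8` by `ae_dimH_range_sleTrace_eq_of_lt_eight_of_estimates`, `κ = 8` by
`ae_dimH_range_sleTrace_eight_of_hasSLETrace_eight`. Compared with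
`ae_dimH_range_sleTrace_of_root_facts_of_onePoint_of_twoPoint` (`CritPercSLEDimensionLower.lean`)
the Rohde–Schramm root facts (Thm. 5.1, Thm. 7.1, Lemma 6.3 with (6.2)) and the one-point upper
estimate are no longer hypotheses: they are theorems of the tree.
[cite: Beffara2008, Theorem (Introduction), Prop. 4 and (3.5); LawlerSchrammWerner2004, Thm 4.7] -/
theorem ae_dimH_range_sleTrace_of_hasSLETrace_eight_of_lower_estimates (h8e : hasSLETrace_eight)
    (hB : ∀ {κ : ℝ≥0}, 0 < κ → κ < 8 → ∀ K : Set ℂ, IsCompact K → K ⊆ upperHalfPlaneSet →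
      ∃ c₁ : ℝ≥0∞, c₁ ≠ 0 ∧ ∃ ε₀ : ℝ, 0 < ε₀ ∧ ∀ ε : ℝ, 0 < ε → ε ≤ ε₀ → ∀ z ∈ K,
        c₁ * ENNReal.ofReal (ε ^ (1 - (κ : ℝ) / 8)) ≤
          preWienerMeasure {ω | infDist z (range (sleTrace κ ω)) ≤ ε})
    (hC : ∀ {κ : ℝ≥0}, 0 < κ → κ < 8 → ∀ K : Set ℂ, IsCompact K → K ⊆ upperHalfPlaneSet →
      ∃ c₃ : ℝ≥0∞, c₃ ≠ ⊤ ∧ ∃ ε₀ : ℝ, 0 < ε₀ ∧ ∀ ε : ℝ, 0 < ε → ε ≤ ε₀ → ∀ x ∈ K, ∀ y ∈ K,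
        preWienerMeasure {ω | infDist x (range (sleTrace κ ω)) ≤ ε ∧
            infDist y (range (sleTrace κ ω)) ≤ ε} ≤
          c₃ * ENNReal.ofReal (ε ^ (1 - (κ : ℝ) / 8)) ^ 2 * rieszKernel (1 - (κ : ℝ) / 8) x y)
    {κ : ℝ≥0} : ae_dimH_range_sleTrace (κ := κ) := by
  intro hκ0 hκ8
  rcases hκ8.lt_or_eq with hlt | rfl
  · exact ae_dimH_range_sleTrace_eq_of_lt_eight_of_estimates hκ0 hlt (hB hκ0 hlt) (hC hκ0 hlt)
  · exact ae_dimH_range_sleTrace_eight_of_hasSLETrace_eight h8e hκ0 hκ8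

end Literature.Probability.RandomPlanarGeometry

end
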